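import Literature.InformationTheory.QuantumCodes.QuantumExpanderThresholdSharp
import Literature.InformationTheory.QuantumCodes.FGL18Section6Numerics
import HarnessLib

/-!
# FGL18 Theorem 1 with the printed threshold and the PAPER'S adjacency degree `d = d_B² + 2d_B(d_A − 1)` — PROOF

Index of sources: `[cite: FawziGrospellierLeverrier2018]` = Fawzi–Grospellier–Leverrier, STOC 2018 / arXiv:1711.08351v2:
Thm 1 (§1 p0004) and its proof (end of §4, p0014 L1-16: "We let `p₀ = p_ls` … where `𝒢` is the adjacency graph of the
quantum expander code"), §2.4 (`𝒢`: two qubits adjacent iff some generator acts on both), §6 (p0017 L7: "the degree of the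
syndrome adjacency graph is then `d = d_B² + 2d_B(d_A − 1) = 4407`"; p0017 L10: "`p_ls … ≈ 2.70·10⁻¹⁶`");
`[cite: LeverrierTillichZemor2015]` for the incidences of `𝒢_X`, `𝒢_Z` (arXiv:1504.00822v1 §2–3).

qec PARTITION v2 row 04 (`prover-qec-type-04`, gen 6), item «04.ADJDEG» (lead g8 block 204/205 candidate (β)). The tree's
`QuantumExpander.fgl18_theorem1_sharp` bounds the degree of the adjacency graph `checkGraph (H_X; H_Z)` of `Q_G` by the
generic LDPC estimate `2·max(Δ_A,Δ_B)·(Δ_A+Δ_B)` (= 6006 at `(38,39)`), which costs a factor `≈ 0.329` in the threshold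
against the paper's `d = 4407` (`fgl18_theorem1_sharp_percolationValue_38_39` vs `fgl18_section6_percolationValue`). Here the
degree is counted EXACTLY as in §6:

* `degree_checkGraph_fromRows_le_adj` — a qubit `αa ∈ A²` is adjacent only to the `≤ Δ_A(Δ_B−1)` qubits `αa'` (`a'` at
  distance two from `a`), the `≤ Δ_A(Δ_B−1)` qubits `α'a`, and the `≤ Δ_A²` qubits `bβ` (`b ∼ α`, `β ∼ a`; its `X`- and
  `Z`-neighbourhoods in `B²` coincide); symmetrically for `bβ ∈ B²`. So `deg ≤ max(Δ_A² + 2Δ_A(Δ_B−1), Δ_B² + 2Δ_B(Δ_A−1))`;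
* `fgl18_theorem1_sharp_adj` — `fgl18_theorem1_sharp` with `Δ_𝒢′ = max(3, Δ_A² + 2Δ_A(Δ_B−1), Δ_B² + 2Δ_B(Δ_A−1))` (the `3`
  only matters for `Δ_A = Δ_B = 1`);
* `fgl18_theorem1_sharp_adj_degree_38_39`, `fgl18_theorem1_sharp_adj_percolationValue_38_39` — at `(Δ_A,Δ_B,δ_A,δ_B) =
  (38,39,1/38,1/39)`: `Δ_𝒢′ = 4407` and the threshold of OUR theorem is the PRINTED `p_ls(4407, α) ∈ (2.70243, 2.70244)·10⁻¹⁶`.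

All statements PROVED (kernel axioms); no definitions, no named facts.
-/

namespace Literature.InformationTheory.QuantumCodes

namespace QuantumExpander

open Finset Matrix Literature.Probability.LatticeModels

/-! ### Incidences and the exact degree of the adjacency graph -/

section Degree

variable {A B : Type*} [Fintype A] [Fintype B] [DecidableEq A] [DecidableEq B]

omit [Fintype A] [Fintype B] in
/-- Incidence of an `A²`-qubit with an `X`-check: `αa ∈ check (α', β)` iff `α' = α` and `β ∼ a`.
[cite: LeverrierTillichZemor2015, §2 (𝒢_X: "Γ(αa) = {αβ : a ∼ β}"; arXiv v1 p0005)] -/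
theorem expanderHX_inl_ne_zero_iff (H : Matrix B A (ZMod 2)) (α' : A) (β : B) (α a : A) :
    expanderHX H (α', β) (Sum.inl (α, a)) ≠ 0 ↔ α' = α ∧ H β a ≠ 0 := by
  simp only [expanderHX, HypergraphProduct.zMatrix_apply_inl, Matrix.transpose_apply]
  by_cases h : α' = α <;> simp [h]

omit [Fintype A] [Fintype B] in
/-- Incidence of a `B²`-qubit with an `X`-check: `bβ' ∈ check (α, β)` iff `b ∼ α` and `β = β'`.
[cite: LeverrierTillichZemor2015, §2 (𝒢_X: "Γ(bβ) = {αβ : α ∼ b}"; arXiv v1 p0005)] -/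
theorem expanderHX_inr_ne_zero_iff (H : Matrix B A (ZMod 2)) (α : A) (β : B) (b : B) (β' : B) :
    expanderHX H (α, β) (Sum.inr (b, β')) ≠ 0 ↔ H b α ≠ 0 ∧ β = β' := by
  simp only [expanderHX, HypergraphProduct.zMatrix_apply_inr]
  by_cases h : β = β' <;> simp [h]

omit [Fintype A] [Fintype B] in
/-- Incidence of an `A²`-qubit with a `Z`-generator: `αa' ∈ g_{ba}` iff `α ∼ b` and `a' = a`.
[cite: LeverrierTillichZemor2015, §3 eq. (g_ba) (arXiv v1 p0007)] -/
theorem expanderHZ_inl_ne_zero_iff (H : Matrix B A (ZMod 2)) (b : B) (a : A) (α a' : A) :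
    expanderHZ H (b, a) (Sum.inl (α, a')) ≠ 0 ↔ H b α ≠ 0 ∧ a = a' := by
  rw [expanderHZ_row_apply_inl]
  by_cases h : a = a' <;> simp [h]

omit [Fintype A] [Fintype B] in
/-- Incidence of a `B²`-qubit with a `Z`-generator: `b'β ∈ g_{ba}` iff `b' = b` and `β ∼ a`.
[cite: LeverrierTillichZemor2015, §3 eq. (g_ba) (arXiv v1 p0007)] -/
theorem expanderHZ_inr_ne_zero_iff (H : Matrix B A (ZMod 2)) (b : B) (a : A) (b' β : B) :
    expanderHZ H (b, a) (Sum.inr (b', β)) ≠ 0 ↔ b = b' ∧ H β a ≠ 0 := by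
  rw [expanderHZ_row_apply_inr]
  by_cases h : b = b' <;> simp [h]

/-- **The degree of the adjacency graph `𝒢` of `Q_G`, exactly as in FGL18 §6**: a qubit `αa ∈ A²` is adjacent (shares an
`X`-check or a `Z`-generator) only to the `≤ Δ_A(Δ_B − 1)` qubits `αa'` with `a' ≠ a` at distance 2 from `a`, the
`≤ Δ_A(Δ_B − 1)` qubits `α'a` with `α'` at distance 2 from `α`, and the `≤ Δ_A²` qubits `bβ` with `b ∼ α`, `β ∼ a`; symmetrically
for `bβ ∈ B²`. Hence `deg ≤ max(Δ_A² + 2Δ_A(Δ_B−1), Δ_B² + 2Δ_B(Δ_A−1))` — the paper's `d = d_B² + 2d_B(d_A − 1)`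
(`= 4407` at `(38, 39)`). [cite: FawziGrospellierLeverrier2018, §6 (arXiv v2 p0017 L7: "the degree of the syndrome adjacency graph is then d = d_B² + 2d_B(d_A − 1)")] -/
theorem degree_checkGraph_fromRows_le_adj (H : Matrix B A (ZMod 2)) {dA dB : ℕ} (hreg : IsBiregular H dA dB)
    [DecidableRel (checkGraph (Matrix.fromRows (expanderHX H) (expanderHZ H))).Adj]
    (q : (A × A) ⊕ (B × B)) :
    (checkGraph (Matrix.fromRows (expanderHX H) (expanderHZ H))).degree q
      ≤ max (dA * dA + 2 * (dA * (dB - 1))) (dB * dB + 2 * (dB * (dA - 1))) := by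
  classical
  rw [← SimpleGraph.card_neighborFinset_eq_degree]
  rcases q with ⟨α, a⟩ | ⟨b, β⟩
  · -- the three candidate sets
    set T1 : Finset ((A × A) ⊕ (B × B)) :=
      ((nbrs H a).biUnion fun β => (univ.filter fun a' : A => H β a' ≠ 0).erase a).image
        fun a' => Sum.inl (α, a') with hT1
    set T2 : Finset ((A × A) ⊕ (B × B)) :=
      ((nbrs H α).biUnion fun b => (univ.filter fun α' : A => H b α' ≠ 0).erase α).image
        fun α' => Sum.inl (α', a) with hT2
    set T3 : Finset ((A × A) ⊕ (B × B)) :=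
      ((nbrs H α) ×ˢ (nbrs H a)).image fun bβ => Sum.inr (bβ.1, bβ.2) with hT3
    have hsub : (checkGraph (Matrix.fromRows (expanderHX H) (expanderHZ H))).neighborFinset (Sum.inl (α, a))
        ⊆ T1 ∪ T2 ∪ T3 := by
      intro u hu
      rw [SimpleGraph.mem_neighborFinset] at hu
      obtain ⟨hne, i, hiq, hiu⟩ := hu
      rw [Finset.mem_union, Finset.mem_union]
      rcases i with ⟨α', β⟩ | ⟨b, a'⟩
      · rw [Matrix.fromRows_apply_inl] at hiq hiu
        obtain ⟨hα, hβa⟩ := (expanderHX_inl_ne_zero_iff H α' β α a).1 hiq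
        subst hα
        rcases u with ⟨α'', a''⟩ | ⟨b'', β''⟩
        · obtain ⟨hα'', hβa''⟩ := (expanderHX_inl_ne_zero_iff H α' β α'' a'').1 hiu
          subst hα''
          left; left
          rw [hT1, Finset.mem_image]
          refine ⟨a'', Finset.mem_biUnion.2 ⟨β, mem_nbrs.2 hβa, Finset.mem_erase.2 ⟨?_, ?_⟩⟩, rfl⟩
          · intro h; subst h; exact hne rfl
          · exact Finset.mem_filter.2 ⟨Finset.mem_univ _, hβa''⟩
        · obtain ⟨hb'', hβ''⟩ := (expanderHX_inr_ne_zero_iff H α' β b'' β'').1 hiu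
          subst hβ''
          right
          rw [hT3, Finset.mem_image]
          exact ⟨(b'', β), Finset.mem_product.2 ⟨mem_nbrs.2 hb'', mem_nbrs.2 hβa⟩, rfl⟩
      · rw [Matrix.fromRows_apply_inr] at hiq hiu
        obtain ⟨hbα, ha⟩ := (expanderHZ_inl_ne_zero_iff H b a' α a).1 hiq
        subst ha
        rcases u with ⟨α'', a''⟩ | ⟨b'', β''⟩
        · obtain ⟨hbα'', ha''⟩ := (expanderHZ_inl_ne_zero_iff H b a' α'' a'').1 hiu
          subst ha''
          left; right
          rw [hT2, Finset.mem_image]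
          refine ⟨α'', Finset.mem_biUnion.2 ⟨b, mem_nbrs.2 hbα, Finset.mem_erase.2 ⟨?_, ?_⟩⟩, rfl⟩
          · intro h; subst h; exact hne rfl
          · exact Finset.mem_filter.2 ⟨Finset.mem_univ _, hbα''⟩
        · obtain ⟨hb'', hβ''⟩ := (expanderHZ_inr_ne_zero_iff H b a' b'' β'').1 hiu
          subst hb''
          right
          rw [hT3, Finset.mem_image]
          exact ⟨(b, β''), Finset.mem_product.2 ⟨mem_nbrs.2 hbα, mem_nbrs.2 hβ''⟩, rfl⟩
    -- cardinalities
    have hrow : ∀ (b : B) (x : A), H b x ≠ 0 → ((univ.filter fun a' : A => H b a' ≠ 0).erase x).card = dB - 1 := by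
      intro b x hx
      have hmem : x ∈ (univ.filter fun a' : A => H b a' ≠ 0) := Finset.mem_filter.2 ⟨Finset.mem_univ _, hx⟩
      rw [Finset.card_erase_of_mem hmem, hreg.2 b]
    have hT1c : T1.card ≤ dA * (dB - 1) := by
      rw [hT1]
      refine Finset.card_image_le.trans (Finset.card_biUnion_le.trans (le_of_eq ?_))
      rw [Finset.sum_congr rfl (fun β hβ => hrow β a (mem_nbrs.1 hβ)), Finset.sum_const, smul_eq_mul,
        card_nbrs_eq H hreg a]
    have hT2c : T2.card ≤ dA * (dB - 1) := by
      rw [hT2]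
      refine Finset.card_image_le.trans (Finset.card_biUnion_le.trans (le_of_eq ?_))
      rw [Finset.sum_congr rfl (fun b hb => hrow b α (mem_nbrs.1 hb)), Finset.sum_const, smul_eq_mul,
        card_nbrs_eq H hreg α]
    have hT3c : T3.card ≤ dA * dA := by
      rw [hT3]
      refine Finset.card_image_le.trans ?_
      rw [Finset.card_product, card_nbrs_eq H hreg α, card_nbrs_eq H hreg a]
    calc _ ≤ (T1 ∪ T2 ∪ T3).card := Finset.card_le_card hsub
      _ ≤ T1.card + T2.card + T3.card :=
          (Finset.card_union_le _ _).trans (Nat.add_le_add_right (Finset.card_union_le _ _) _)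
      _ ≤ dA * (dB - 1) + dA * (dB - 1) + dA * dA := by omega
      _ = dA * dA + 2 * (dA * (dB - 1)) := by ring
      _ ≤ _ := le_max_left _ _
  · -- the `B²` qubit `bβ`: symmetric
    set T1 : Finset ((A × A) ⊕ (B × B)) :=
      ((nbrs Hᵀ β).biUnion fun a => (univ.filter fun β' : B => H β' a ≠ 0).erase β).image
        fun β' => Sum.inr (b, β') with hT1
    set T2 : Finset ((A × A) ⊕ (B × B)) :=
      ((nbrs Hᵀ b).biUnion fun α => (univ.filter fun b' : B => H b' α ≠ 0).erase b).image
        fun b' => Sum.inr (b', β) with hT2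
    set T3 : Finset ((A × A) ⊕ (B × B)) :=
      ((nbrs Hᵀ b) ×ˢ (nbrs Hᵀ β)).image fun αa => Sum.inl (αa.1, αa.2) with hT3
    have hsub : (checkGraph (Matrix.fromRows (expanderHX H) (expanderHZ H))).neighborFinset (Sum.inr (b, β))
        ⊆ T1 ∪ T2 ∪ T3 := by
      intro u hu
      rw [SimpleGraph.mem_neighborFinset] at hu
      obtain ⟨hne, i, hiq, hiu⟩ := hu
      rw [Finset.mem_union, Finset.mem_union]
      rcases i with ⟨α, β'⟩ | ⟨b', a⟩
      · rw [Matrix.fromRows_apply_inl] at hiq hiu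
        obtain ⟨hbα, hβ⟩ := (expanderHX_inr_ne_zero_iff H α β' b β).1 hiq
        subst hβ
        rcases u with ⟨α'', a''⟩ | ⟨b'', β''⟩
        · obtain ⟨hα'', hβa''⟩ := (expanderHX_inl_ne_zero_iff H α β' α'' a'').1 hiu
          subst hα''
          right
          rw [hT3, Finset.mem_image]
          refine ⟨(α, a''), Finset.mem_product.2 ⟨?_, ?_⟩, rfl⟩
          · rw [mem_nbrs, Matrix.transpose_apply]; exact hbα
          · rw [mem_nbrs, Matrix.transpose_apply]; exact hβa''
        · obtain ⟨hb'', hβ''⟩ := (expanderHX_inr_ne_zero_iff H α β' b'' β'').1 hiu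
          subst hβ''
          left; right
          rw [hT2, Finset.mem_image]
          refine ⟨b'', Finset.mem_biUnion.2 ⟨α, ?_, Finset.mem_erase.2 ⟨?_, ?_⟩⟩, rfl⟩
          · rw [mem_nbrs, Matrix.transpose_apply]; exact hbα
          · intro h; subst h; exact hne rfl
          · exact Finset.mem_filter.2 ⟨Finset.mem_univ _, hb''⟩
      · rw [Matrix.fromRows_apply_inr] at hiq hiu
        obtain ⟨hb', hβa⟩ := (expanderHZ_inr_ne_zero_iff H b' a b β).1 hiq
        subst hb'
        rcases u with ⟨α'', a''⟩ | ⟨b'', β''⟩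
        · obtain ⟨hbα'', ha''⟩ := (expanderHZ_inl_ne_zero_iff H b' a α'' a'').1 hiu
          subst ha''
          right
          rw [hT3, Finset.mem_image]
          refine ⟨(α'', a), Finset.mem_product.2 ⟨?_, ?_⟩, rfl⟩
          · rw [mem_nbrs, Matrix.transpose_apply]; exact hbα''
          · rw [mem_nbrs, Matrix.transpose_apply]; exact hβa
        · obtain ⟨hb'', hβ''⟩ := (expanderHZ_inr_ne_zero_iff H b' a b'' β'').1 hiu
          subst hb''
          left; left
          rw [hT1, Finset.mem_image]
          refine ⟨β'', Finset.mem_biUnion.2 ⟨a, ?_, Finset.mem_erase.2 ⟨?_, ?_⟩⟩, rfl⟩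
          · rw [mem_nbrs, Matrix.transpose_apply]; exact hβa
          · intro h; subst h; exact hne rfl
          · exact Finset.mem_filter.2 ⟨Finset.mem_univ _, hβ''⟩
    have hcol : ∀ (x : A) (y : B), H y x ≠ 0 → ((univ.filter fun b' : B => H b' x ≠ 0).erase y).card = dA - 1 := by
      intro x y hy
      have hmem : y ∈ (univ.filter fun b' : B => H b' x ≠ 0) := Finset.mem_filter.2 ⟨Finset.mem_univ _, hy⟩
      rw [Finset.card_erase_of_mem hmem, hreg.1 x]
    have hT1c : T1.card ≤ dB * (dA - 1) := by
      rw [hT1]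
      refine Finset.card_image_le.trans (Finset.card_biUnion_le.trans (le_of_eq ?_))
      rw [Finset.sum_congr rfl (fun a ha => hcol a β (by
          have := mem_nbrs.1 ha; rwa [Matrix.transpose_apply] at this)), Finset.sum_const, smul_eq_mul,
        card_nbrs_transpose_eq H hreg β]
    have hT2c : T2.card ≤ dB * (dA - 1) := by
      rw [hT2]
      refine Finset.card_image_le.trans (Finset.card_biUnion_le.trans (le_of_eq ?_))
      rw [Finset.sum_congr rfl (fun α hα => hcol α b (by
          have := mem_nbrs.1 hα; rwa [Matrix.transpose_apply] at this)), Finset.sum_const, smul_eq_mul,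
        card_nbrs_transpose_eq H hreg b]
    have hT3c : T3.card ≤ dB * dB := by
      rw [hT3]
      refine Finset.card_image_le.trans ?_
      rw [Finset.card_product, card_nbrs_transpose_eq H hreg b, card_nbrs_transpose_eq H hreg β]
    calc _ ≤ (T1 ∪ T2 ∪ T3).card := Finset.card_le_card hsub
      _ ≤ T1.card + T2.card + T3.card :=
          (Finset.card_union_le _ _).trans (Nat.add_le_add_right (Finset.card_union_le _ _) _)
      _ ≤ dB * (dA - 1) + dB * (dA - 1) + dB * dB := by omega
      _ = dB * dB + 2 * (dB * (dA - 1)) := by ring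
      _ ≤ _ := le_max_right _ _


end Degree

/-! ### Theorem 1 with the adjacency degree -/

section SharpAdj

variable {A B : Type} [Fintype A] [Fintype B] [DecidableEq A] [DecidableEq B]

open Classical in
/-- **FGL18 Theorem 1 with the printed threshold value AND the paper's degree bookkeeping.** As
`fgl18_theorem1_sharp` (local stochastic noise `0 < p < p_ls(Δ_𝒢′, α)`, `α = β̃/(1+β̃)`, bound
`C(p)·(n_A²+n_B²)·(p/p_ls)^{α(⌊t₀⌋+1)}`) with the adjacency degree `Δ_𝒢′ = max(3, Δ_A² + 2Δ_A(Δ_B−1), Δ_B² + 2Δ_B(Δ_A−1))`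
("the degree of the syndrome adjacency graph is then `d = d_B² + 2d_B(d_A − 1)`") in place of the generic
`2·max(Δ_A,Δ_B)·(Δ_A+Δ_B)`. STATUS: the printed theorem with the printed threshold formula `p_ls(d, α)` at the printed `d`
(the `max` with `3` and with the `A`-side expression is ours: the paper assumes `d_A ≤ d_B` and large degrees).
[cite: FawziGrospellierLeverrier2018, proof of Thm 1 (arXiv v2 p0014 L1-16) with §6 (p0017 L7: d = d_B² + 2d_B(d_A − 1)) and Thm 17 eq. (problc)] -/
theorem fgl18_theorem1_sharp_adj (H : Matrix B A (ZMod 2)) {dA dB : ℕ} {γA δA γB δB : ℝ}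
    (hreg : IsBiregular H dA dB) (hexp : IsLeftRightExpanding H dA dB γA δA γB δB)
    (hdA : 0 < dA) (hdB : 0 < dB) (hγA : 0 < γA) (hδA : 0 < δA) (hγB : 0 < γB) (hδB : 0 < δB)
    (hβ : 0 < betaZero (min dA dB) (max dA dB) δA δB)
    {κ : ℝ} (hκ : κ ≤ betaZero (min dA dB) (max dA dB) δA δB * ((max dA dB : ℕ) : ℝ))
    {D : Decoder (A × B → ZMod 2) ((A × A) ⊕ (B × B) → ZMod 2)}
    (hD : IsSSFDecoder κ (expanderHX H) (expanderHZ H) D)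
    {p : ℝ} {μ : Finset ((A × A) ⊕ (B × B)) → ℝ} (hμ : IsLocallyStochastic μ p) (hp0 : 0 < p)
    (hp : p < percolationValue (max 3 (max (dA * dA + 2 * (dA * (dB - 1))) (dB * dB + 2 * (dB * (dA - 1)))))
      (betaZero (min dA dB) (max dA dB) δA δB / (1 + betaZero (min dA dB) (max dA dB) δA δB))) :
    (∑ E ∈ univ.filter (fun E : Finset ((A × A) ⊕ (B × B)) =>
        ¬ D.Corrects (fun x => expanderHX H *ᵥ x) (rowSpace (expanderHZ H) : Set _) (flipVec E)), μ E)
      ≤ (1 / ((1 - Real.exp (Real.binEntropy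
                  (betaZero (min dA dB) (max dA dB) δA δB / (1 + betaZero (min dA dB) (max dA dB) δA δB)) /
                (betaZero (min dA dB) (max dA dB) δA δB / (1 + betaZero (min dA dB) (max dA dB) δA δB))) * p) *
              (1 - (p / percolationValue (max 3 (max (dA * dA + 2 * (dA * (dB - 1))) (dB * dB + 2 * (dB * (dA - 1)))))
                (betaZero (min dA dB) (max dA dB) δA δB / (1 + betaZero (min dA dB) (max dA dB) δA δB))) ^
                  (betaZero (min dA dB) (max dA dB) δA δB / (1 + betaZero (min dA dB) (max dA dB) δA δB))))) *
        ((Fintype.card A : ℝ) ^ 2 + (Fintype.card B : ℝ) ^ 2) *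
        (p / percolationValue (max 3 (max (dA * dA + 2 * (dA * (dB - 1))) (dB * dB + 2 * (dB * (dA - 1)))))
            (betaZero (min dA dB) (max dA dB) δA δB / (1 + betaZero (min dA dB) (max dA dB) δA δB))) ^
          ((betaZero (min dA dB) (max dA dB) δA δB / (1 + betaZero (min dA dB) (max dA dB) δA δB)) *
            ((⌊((min dA dB : ℕ) : ℝ) / ((max dA dB : ℕ) : ℝ) * betaZero (min dA dB) (max dA dB) δA δB
                / (1 + betaZero (min dA dB) (max dA dB) δA δB) * min (γA * Fintype.card A) (γB * Fintype.card B)⌋₊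
                + 1 : ℕ) : ℝ)) := by
  classical
  -- names
  set dM : ℕ := max dA dB with hdMdef
  set β : ℝ := betaZero (min dA dB) (max dA dB) δA δB with hβdef
  set κ₀ : ℝ := β * dM with hκ₀def
  set t₀ : ℝ := ((min dA dB : ℕ) : ℝ) / ((max dA dB : ℕ) : ℝ) * β / (1 + β) *
    min (γA * Fintype.card A) (γB * Fintype.card B) with ht₀def
  have hdM0 : 0 < dM := lt_max_of_lt_left hdA
  have hdM' : (0 : ℝ) < dM := by exact_mod_cast hdM0
  have hκ₀pos : 0 < κ₀ := mul_pos hβ hdM'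
  have hα : κ₀ / (κ₀ + dM) = β / (1 + β) := by
    rw [hκ₀def]
    field_simp
    ring
  -- Remark 9: dominate the `κ`-decoder by a `κ₀`-decoder
  obtain ⟨D₀, hD₀, hdom⟩ := SmallSetFlip.exists_dominating_sum_le hκ
    (fun _ hv => expanderHX_mulVec_eq_zero_of_mem_rowSpace H hv) hD (fun E => hμ.nonneg E)
  refine hdom.trans ?_
  -- the adjacency graph and the hypotheses of the generic reduction
  set G := checkGraph (Matrix.fromRows (expanderHX H) (expanderHZ H)) with hGdef
  have hGX : ∀ c q q', q ≠ q' → expanderHX H c q ≠ 0 → expanderHX H c q' ≠ 0 → G.Adj q q' :=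
    fun c q q' hne h1 h2 => checkGraph_fromRows_adj_of_X H c q q' hne h1 h2
  have hGZ : ∀ g q q', q ≠ q' → expanderHZ H g q ≠ 0 → expanderHZ H g q' ≠ 0 → G.Adj q q' :=
    fun g q q' hne h1 h2 => checkGraph_fromRows_adj_of_Z H g q q' hne h1 h2
  have hw : ∀ v : (A × A) ⊕ (B × B) → ZMod 2,
      (hammingNorm (expanderHX H *ᵥ v) : ℝ) ≤ (dM : ℝ) * hammingNorm v := fun v => by
    rw [hdMdef]; exact_mod_cast hammingNorm_expanderHX_mulVec_le_max H hreg v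
  have ht₀ : 0 ≤ t₀ := by
    rw [ht₀def]
    have : 0 ≤ min (γA * Fintype.card A) (γB * Fintype.card B) :=
      le_min (mul_nonneg hγA.le (Nat.cast_nonneg _)) (mul_nonneg hγB.le (Nat.cast_nonneg _))
    have hb : 0 ≤ β / (1 + β) := div_nonneg hβ.le (by linarith)
    have : 0 ≤ ((min dA dB : ℕ) : ℝ) / ((max dA dB : ℕ) : ℝ) * β / (1 + β) := by positivity
    positivity
  have hcorr : ∀ (E' : Finset ((A × A) ⊕ (B × B))) (l' : List (Finset ((A × A) ⊕ (B × B)))),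
      IsSSFRun κ₀ (expanderHX H) (expanderHZ H) (expanderHX H *ᵥ flipVec E') l' →
      ((E'.card : ℝ) ≤ t₀) → flipVec E' + runOutput l' ∈ rowSpace (expanderHZ H) := by
    intro E' l' hrun hE'
    have hrun' : IsSSFRun (betaZero (min dA dB) (max dA dB) δA δB * ((max dA dB : ℕ) : ℝ))
        (expanderHX H) (expanderHZ H) (expanderHX H *ᵥ flipVec E') l' := by
      rw [← hdMdef, ← hβdef, ← hκ₀def]; exact hrun
    refine add_runOutput_mem_rowSpace_minmax H hreg hexp hdA hdB hδA hδB (by rw [← hβdef]; exact hβ) hrun' ?_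
    rw [hammingNorm_flipVec, ← hβdef]
    exact hE'.trans_eq (by rw [ht₀def])
  have hdeg : ∀ x, G.degree x ≤ (max 3 (max (dA * dA + 2 * (dA * (dB - 1))) (dB * dB + 2 * (dB * (dA - 1))))) :=
    fun x => (degree_checkGraph_fromRows_le_adj H hreg x).trans (le_max_right _ _)
  have hd3 : 3 ≤ (max 3 (max (dA * dA + 2 * (dA * (dB - 1))) (dB * dB + 2 * (dB * (dA - 1))))) := le_max_left _ _
  -- the sharp generic bound with the adjacency degree
  have hp' : p < percolationValue (max 3 (max (dA * dA + 2 * (dA * (dB - 1))) (dB * dB + 2 * (dB * (dA - 1))))) (κ₀ / (κ₀ + dM)) := by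
    rw [hα]; exact hp
  have key := SmallSetFlip.sum_not_corrects_le_sharp (G := G) hGX hGZ hκ₀pos hdM'.le hw ht₀ hcorr hD₀ hd3 hdeg
    hμ hp0 hp'
  rw [hα, card_qubits] at key
  exact_mod_cast key

/-- At `(Δ_A, Δ_B) = (38, 39)` the adjacency degree is the printed `d = 39² + 2·39·37 = 4407`.
[cite: FawziGrospellierLeverrier2018, §6 (arXiv v2 p0017 L7: "d = d_B² + 2d_B(d_A − 1) = 4407")] -/
theorem fgl18_theorem1_sharp_adj_degree_38_39 :
    max 3 (max (38 * 38 + 2 * (38 * (39 - 1))) (39 * 39 + 2 * (39 * (38 - 1)))) = 4407 := by norm_num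

/-- **The threshold of OUR theorem `fgl18_theorem1_sharp_adj` at the §6 parameters is the PRINTED number**: for
`(Δ_A, Δ_B, δ_A, δ_B) = (38, 39, 1/38, 1/39)`, `p₀ = percolationValue Δ_𝒢′ (β̃/(1+β̃)) = p_ls(4407, 434966/1562027)`
satisfies `2.70243·10⁻¹⁶ < p₀ < 2.70244·10⁻¹⁶` (the tree's `fgl18_section6_percolationValue`; printed "`≈ 2.70·10⁻¹⁶`").
[cite: FawziGrospellierLeverrier2018, §6 (arXiv v2 p0017 L1-12: "p_ls … ≈ 2.70·10⁻¹⁶")] -/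
theorem fgl18_theorem1_sharp_adj_percolationValue_38_39 :
    (270243 : ℝ) / 10 ^ 21 <
        percolationValue (max 3 (max (38 * 38 + 2 * (38 * (39 - 1))) (39 * 39 + 2 * (39 * (38 - 1)))))
          (betaZero (min 38 39) (max 38 39) (1 / 38) (1 / 39) / (1 + betaZero (min 38 39) (max 38 39) (1 / 38) (1 / 39))) ∧
      percolationValue (max 3 (max (38 * 38 + 2 * (38 * (39 - 1))) (39 * 39 + 2 * (39 * (38 - 1)))))
          (betaZero (min 38 39) (max 38 39) (1 / 38) (1 / 39) / (1 + betaZero (min 38 39) (max 38 39) (1 / 38) (1 / 39)))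
        < (270244 : ℝ) / 10 ^ 21 := by
  have hmin : min 38 39 = 38 := by norm_num
  have hmax : max 38 39 = 39 := by norm_num
  rw [fgl18_theorem1_sharp_adj_degree_38_39, hmin, hmax]
  exact fgl18_section6_percolationValue

end SharpAdj

end QuantumExpander

end Literature.InformationTheory.QuantumCodes
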